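import Mathlib
import Summits.ValiantsHypothesis.ValiantsHypothesis.Theorems.RigidityForcesSymmetryRankRigidMinimalReprLaplaceFiveSeparatedCaptureSliceRows

/-!
# Letter deletion: slices at a letter plus the killed configuration

A reduction for the 3-slot capture inequality `CaptureIneqSym` (item 24813 stays OPEN; nothing here claims it).

Fix a letter `c` and the KILLING map `x ↦ x♭` (zero out row and column `c`).  An obligation `T_μ` whose `c`-slice vanishes
avoids the letter `c` altogether, and rewriting its finite form `T_μ = Σ A_r ⊗ … + B + C` (✓ `L3_finite_form`) with every short
matrix replaced by its kill (and the pieces carried by the vector index `c` dropped) shows that `T_μ` is captured by the KILLED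
configuration `(U₀₁♭, U₀₂♭, U₁₂♭)` (`contractZ_mem_L3_killed`).  The killed configuration lives on four letters, where
`CaptureIneqSym` is a theorem (✓ `captureIneqSym_of_four_letters`).  With the slice step (✓ `finrank_le_of_slice_step`):

  `finrank W ≤ finrank Y_c + finrank U₀₁♭ + finrank U₀₂♭ + finrank U₁₂♭`

for any `Y_c` containing the `c`-slices of the obligations (`finrank_le_slice_add_killed`), and hence the CROSS-PAYS-SLICES
criterion: `CaptureIneqSym` holds for a configuration as soon as, at SOME letter `c`, the `c`-slices of its obligations fit in a space
of dimension at most `Σ_i (finrank U_i − finrank U_i♭)` = the total dimension of the parts of the three slots supported on the cross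
of `c` (`captureIneqSym_of_slices_le_cross`).  The killed spans enter through hypotheses (`K_i ⊇ U_i♭`, symmetric, missing `c`), so
any convenient superset may be used.  All [folklore].
-/

set_option linter.dupNamespace false
set_option autoImplicit false

namespace Summit.ValiantsHypothesis.ValiantsHypothesis.Theorems.RigidityForcesSymmetryRankRigidMinimalRepr

namespace LaplaceFiveSeparatedCapture

open Finset

/-! ### Obligations avoiding a letter are captured by the killed configuration -/

/-- ★★ **KILLING A LETTER.**  If the `c`-slice of a captured obligation vanishes, the obligation is captured by any spans
`K₀₁, K₀₂, K₁₂` containing the kills `x♭ = (p,q) ↦ [p ≠ c][q ≠ c]·x p q` of the members of `U₀₁, U₀₂, U₁₂`. [folklore] -/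
theorem contractZ_mem_L3_killed (U01 U02 U12 K01 K02 K12 : Submodule ℂ (Fin 5 → Fin 5 → ℂ)) (c : Fin 5)
    (hK01 : ∀ x ∈ U01, (fun p q => if p = c ∨ q = c then (0 : ℂ) else x p q) ∈ K01)
    (hK02 : ∀ x ∈ U02, (fun p q => if p = c ∨ q = c then (0 : ℂ) else x p q) ∈ K02)
    (hK12 : ∀ x ∈ U12, (fun p q => if p = c ∨ q = c then (0 : ℂ) else x p q) ∈ K12)
    (μ : Fin 5 → Fin 5 → ℂ) (hμ : contractZ μ ∈ L3 U01 U02 U12) (h0 : (fun p q => contractZ μ p q c) = 0) :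
    contractZ μ ∈ L3 K01 K02 K12 := by
  classical
  obtain ⟨A, B, C, hA, hB, hC, hT⟩ := L3_finite_form U01 U02 U12 hμ
  have hz3 : ∀ p q, contractZ μ p q c = 0 := fun p q => congrFun (congrFun h0 p) q
  have hz2 : ∀ p r, contractZ μ p c r = 0 := fun p r => by rw [contractZ_swap23 μ p r c]; exact hz3 p r
  have hz1 : ∀ q r, contractZ μ c q r = 0 := fun q r => by rw [contractZ_swap12 μ q c r]; exact hz2 q r
  -- killed tuples (the pieces carried by the vector index `c` are dropped as well)
  let A' : Fin 5 → Fin 5 → Fin 5 → ℂ := fun r p q => if r = c then 0 else if p = c ∨ q = c then 0 else A r p q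
  let B' : Fin 5 → Fin 5 → Fin 5 → ℂ := fun q p r => if q = c then 0 else if p = c ∨ r = c then 0 else B q p r
  let C' : Fin 5 → Fin 5 → Fin 5 → ℂ := fun p q r => if p = c then 0 else if q = c ∨ r = c then 0 else C p q r
  have hA' : ∀ r, A' r ∈ K01 := fun r => by
    by_cases hr : r = c
    · have : A' r = 0 := by funext p q; simp [A', hr]
      rw [this]; exact Submodule.zero_mem _
    · have : A' r = fun p q => if p = c ∨ q = c then (0 : ℂ) else A r p q := by funext p q; simp [A', hr]
      rw [this]; exact hK01 _ (hA r)
  have hB' : ∀ q, B' q ∈ K02 := fun q => by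
    by_cases hq : q = c
    · have : B' q = 0 := by funext p r; simp [B', hq]
      rw [this]; exact Submodule.zero_mem _
    · have : B' q = fun p r => if p = c ∨ r = c then (0 : ℂ) else B q p r := by funext p r; simp [B', hq]
      rw [this]; exact hK02 _ (hB q)
  have hC' : ∀ p, C' p ∈ K12 := fun p => by
    by_cases hp : p = c
    · have : C' p = 0 := by funext q r; simp [C', hp]
      rw [this]; exact Submodule.zero_mem _
    · have : C' p = fun q r => if q = c ∨ r = c then (0 : ℂ) else C p q r := by funext q r; simp [C', hp]
      rw [this]; exact hK12 _ (hC p)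
  have e : contractZ μ = (fun p q r => A' r p q) + (fun p q r => B' q p r) + (fun p q r => C' p q r) := by
    funext p q r
    simp only [Pi.add_apply, A', B', C']
    by_cases hp : p = c
    · rw [hp, hz1]; simp
    by_cases hq : q = c
    · rw [hq, hz2]; simp
    by_cases hr : r = c
    · rw [hr, hz3]; simp
    simp only [hp, hq, hr, if_false, or_self]
    exact hT p q r
  rw [e]
  exact Submodule.add_mem _ (Submodule.add_mem _ (placed01_mem_L3 K01 K02 K12 A' hA') (placed02_mem_L3 K01 K02 K12 B' hB'))
    (placed12_mem_L3 K01 K02 K12 C' hC')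

/-- The kill of a symmetric matrix is symmetric and misses the letter `c`. [folklore] -/
theorem kill_shape (x : Fin 5 → Fin 5 → ℂ) (hx : ∀ p q, x p q = x q p) (c : Fin 5) :
    (∀ p q : Fin 5, (fun p q => if p = c ∨ q = c then (0 : ℂ) else x p q) p q
        = (fun p q => if p = c ∨ q = c then (0 : ℂ) else x p q) q p) ∧
      ∀ q : Fin 5, (fun p q => if p = c ∨ q = c then (0 : ℂ) else x p q) c q = 0 := by
  refine ⟨fun p q => ?_, fun q => by simp⟩
  show (if p = c ∨ q = c then (0 : ℂ) else x p q) = if q = c ∨ p = c then (0 : ℂ) else x q p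
  by_cases h : p = c ∨ q = c
  · rw [if_pos h, if_pos h.symm]
  · rw [if_neg h, if_neg (fun h' => h h'.symm), hx p q]

/-! ### The count -/

/-- ★★★ **LETTER DELETION COUNT.**  For any letter `c`: `finrank W ≤ finrank Y + finrank K₀₁ + finrank K₀₂ + finrank K₁₂` whenever
`Y` contains the `c`-slices of the obligations of `W` and `K₀₁, K₀₂, K₁₂` are symmetric spans missing the letter `c` and containing
the kills of the members of `U₀₁, U₀₂, U₁₂` (e.g. the killed spans `U_i♭` themselves, `finrank U_i♭ = finrank U_i − finrank (U_i ∩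
cross of c)`).  Slice step + ✓ `captureIneqSym_of_four_letters` on the killed configuration. [folklore] -/
theorem finrank_le_slice_add_killed (U01 U02 U12 W Y K01 K02 K12 : Submodule ℂ (Fin 5 → Fin 5 → ℂ)) (c d a b e : Fin 5)
    (hcov : ∀ x : Fin 5, x = c ∨ x = d ∨ x = a ∨ x = b ∨ x = e)
    (hK01 : ∀ x ∈ U01, (fun p q => if p = c ∨ q = c then (0 : ℂ) else x p q) ∈ K01)
    (hK02 : ∀ x ∈ U02, (fun p q => if p = c ∨ q = c then (0 : ℂ) else x p q) ∈ K02)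
    (hK12 : ∀ x ∈ U12, (fun p q => if p = c ∨ q = c then (0 : ℂ) else x p q) ∈ K12)
    (k01 : ∀ x ∈ K01, ∀ p q : Fin 5, x p q = x q p) (k02 : ∀ x ∈ K02, ∀ p q : Fin 5, x p q = x q p)
    (k12 : ∀ x ∈ K12, ∀ p q : Fin 5, x p q = x q p) (hKc : ∀ x ∈ K01 ⊔ K02 ⊔ K12, ∀ q : Fin 5, x c q = 0)
    (hY : ∀ μ ∈ W, (fun p q => contractZ μ p q c) ∈ Y)
    (hWs : ∀ μ ∈ W, ∀ s t : Fin 5, μ s t = μ t s) (hWd : ∀ μ ∈ W, ∀ s : Fin 5, μ s s = 0)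
    (hWc : ∀ μ ∈ W, contractZ μ ∈ L3 U01 U02 U12) :
    Module.finrank ℂ W ≤ Module.finrank ℂ Y + Module.finrank ℂ K01 + Module.finrank ℂ K02 + Module.finrank ℂ K12 := by
  let sl : (Fin 5 → Fin 5 → Fin 5 → ℂ) →ₗ[ℂ] (Fin 5 → Fin 5 → ℂ) :=
    { toFun := fun T p q => T p q c, map_add' := fun _ _ => rfl, map_smul' := fun _ _ => rfl }
  let W' : Submodule ℂ (Fin 5 → Fin 5 → ℂ) := W ⊓ LinearMap.ker (sl.comp cZ)
  have hW'mem : ∀ μ : Fin 5 → Fin 5 → ℂ, μ ∈ W' ↔ μ ∈ W ∧ (fun p q => contractZ μ p q c) = 0 := fun μ => Iff.rfl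
  have h1 := finrank_le_of_slice_step W W' Y c hY (fun μ hμ h0 => (hW'mem μ).mpr ⟨hμ, h0⟩)
  have h2 := captureIneqSym_of_four_letters K01 K02 K12 W' k01 k02 k12 c d a b e hcov hKc
    (fun μ hμ => hWs μ ((hW'mem μ).mp hμ).1) (fun μ hμ => hWd μ ((hW'mem μ).mp hμ).1)
    (fun μ hμ => contractZ_mem_L3_killed U01 U02 U12 K01 K02 K12 c hK01 hK02 hK12 μ (hWc μ ((hW'mem μ).mp hμ).1)
      ((hW'mem μ).mp hμ).2)
  omega

/-- ★★★ **CROSS-PAYS-SLICES CRITERION for `CaptureIneqSym`.**  If at some letter `c` the `c`-slices of the obligations fit in a space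
`Y` with `finrank Y + Σ finrank K_i ≤ Σ finrank U_i` for killed spans `K_i ⊇ U_i♭` — i.e. `finrank Y` is at most the total
dimension of the cross-supported parts of the three slots — then `finrank W ≤ Σ finrank U_i`. [folklore] -/
theorem captureIneqSym_of_slices_le_cross (U01 U02 U12 W Y K01 K02 K12 : Submodule ℂ (Fin 5 → Fin 5 → ℂ)) (c d a b e : Fin 5)
    (hcov : ∀ x : Fin 5, x = c ∨ x = d ∨ x = a ∨ x = b ∨ x = e)
    (hK01 : ∀ x ∈ U01, (fun p q => if p = c ∨ q = c then (0 : ℂ) else x p q) ∈ K01)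
    (hK02 : ∀ x ∈ U02, (fun p q => if p = c ∨ q = c then (0 : ℂ) else x p q) ∈ K02)
    (hK12 : ∀ x ∈ U12, (fun p q => if p = c ∨ q = c then (0 : ℂ) else x p q) ∈ K12)
    (k01 : ∀ x ∈ K01, ∀ p q : Fin 5, x p q = x q p) (k02 : ∀ x ∈ K02, ∀ p q : Fin 5, x p q = x q p)
    (k12 : ∀ x ∈ K12, ∀ p q : Fin 5, x p q = x q p) (hKc : ∀ x ∈ K01 ⊔ K02 ⊔ K12, ∀ q : Fin 5, x c q = 0)
    (hY : ∀ μ ∈ W, (fun p q => contractZ μ p q c) ∈ Y)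
    (hle : Module.finrank ℂ Y + Module.finrank ℂ K01 + Module.finrank ℂ K02 + Module.finrank ℂ K12
      ≤ Module.finrank ℂ U01 + Module.finrank ℂ U02 + Module.finrank ℂ U12)
    (hWs : ∀ μ ∈ W, ∀ s t : Fin 5, μ s t = μ t s) (hWd : ∀ μ ∈ W, ∀ s : Fin 5, μ s s = 0)
    (hWc : ∀ μ ∈ W, contractZ μ ∈ L3 U01 U02 U12) :
    Module.finrank ℂ W ≤ Module.finrank ℂ U01 + Module.finrank ℂ U02 + Module.finrank ℂ U12 :=
  (finrank_le_slice_add_killed U01 U02 U12 W Y K01 K02 K12 c d a b e hcov hK01 hK02 hK12 k01 k02 k12 hKc hY hWs hWd hWc).trans hle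

/-- ★★ **THE KILLED SPAN AS AN IMAGE.**  The kill `x ↦ x♭` is linear; the image `U♭` of a symmetric span is symmetric, misses `c`,
and `finrank U♭ + finrank (U ∩ cross of c) = finrank U` — stated here as the bound `finrank U♭ ≤ finrank U − finrank C` for any
`C ≤ U` all of whose members are supported on the cross of `c`. [folklore] -/
theorem exists_killed_span (U C : Submodule ℂ (Fin 5 → Fin 5 → ℂ)) (hU : ∀ x ∈ U, ∀ p q : Fin 5, x p q = x q p) (c : Fin 5)
    (hCU : C ≤ U) (hC : ∀ x ∈ C, ∀ p q : Fin 5, p ≠ c → q ≠ c → x p q = 0) :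
    ∃ K : Submodule ℂ (Fin 5 → Fin 5 → ℂ), (∀ x ∈ U, (fun p q => if p = c ∨ q = c then (0 : ℂ) else x p q) ∈ K) ∧
      (∀ x ∈ K, ∀ p q : Fin 5, x p q = x q p) ∧ (∀ x ∈ K, ∀ q : Fin 5, x c q = 0) ∧
      Module.finrank ℂ K + Module.finrank ℂ C ≤ Module.finrank ℂ U := by
  let kl : (Fin 5 → Fin 5 → ℂ) →ₗ[ℂ] (Fin 5 → Fin 5 → ℂ) :=
    { toFun := fun x p q => if p = c ∨ q = c then 0 else x p q
      map_add' := fun x y => by funext p q; simp only [Pi.add_apply]; split_ifs <;> simp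
      map_smul' := fun t x => by funext p q; simp only [Pi.smul_apply, smul_eq_mul, RingHom.id_apply]; split_ifs <;> simp }
  have hkl : ∀ x : Fin 5 → Fin 5 → ℂ, kl x = fun p q => if p = c ∨ q = c then 0 else x p q := fun x => rfl
  refine ⟨U.map kl, fun x hx => ⟨x, hx, rfl⟩, ?_, ?_, ?_⟩
  · rintro _ ⟨x, hx, rfl⟩ p q
    exact (kill_shape x (hU x hx) c).1 p q
  · rintro _ ⟨x, hx, rfl⟩ q
    exact (kill_shape x (hU x hx) c).2 q
  -- rank–nullity: `C` lies in the kernel of `kl` restricted to `U`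
  have hrn := LinearMap.finrank_range_add_finrank_ker (kl.domRestrict U)
  have hrange : LinearMap.range (kl.domRestrict U) = U.map kl := by
    ext y
    constructor
    · rintro ⟨x, rfl⟩; exact ⟨x.1, x.2, rfl⟩
    · rintro ⟨x, hx, rfl⟩; exact ⟨⟨x, hx⟩, rfl⟩
  have hker : Module.finrank ℂ C ≤ Module.finrank ℂ (LinearMap.ker (kl.domRestrict U)) := by
    let ι : C →ₗ[ℂ] LinearMap.ker (kl.domRestrict U) :=
      { toFun := fun x => ⟨⟨x.1, hCU x.2⟩, by
          rw [LinearMap.mem_ker, LinearMap.domRestrict_apply, hkl]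
          funext p q
          by_cases h : p = c ∨ q = c
          · rw [if_pos h]; rfl
          · rw [if_neg h]; push Not at h; exact hC x.1 x.2 p q h.1 h.2⟩
        map_add' := fun _ _ => rfl, map_smul' := fun _ _ => rfl }
    have hι : Function.Injective ι := fun x y hxy => by
      have := congrArg (fun z : LinearMap.ker (kl.domRestrict U) => (z.1.1 : Fin 5 → Fin 5 → ℂ)) hxy
      exact Subtype.ext this
    exact LinearMap.finrank_le_finrank_of_injective hι
  rw [hrange] at hrn
  omega

end LaplaceFiveSeparatedCapture

end Summit.ValiantsHypothesis.ValiantsHypothesis.Theorems.RigidityForcesSymmetryRankRigidMinimalRepr
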